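import Summits.BirchSwinnertonDyer.BirchSwinnertonDyer.Theorems.EisensteinPrimesResidualStrictEqUnramifiedChar
import Summits.BirchSwinnertonDyer.BirchSwinnertonDyer.Theorems.EisensteinPrimesIndexInputsH0
import Summits.BirchSwinnertonDyer.BirchSwinnertonDyer.Theorems.EisensteinPrimesCharResidualSelmerFinite
import Summits.BirchSwinnertonDyer.BirchSwinnertonDyer.Theorems.EisensteinPrimesResidualPairStableLine
import Summits.BirchSwinnertonDyer.Rank1Residual.X2.NonPrimitiveSelmerCorank
import HarnessLib

/-!
# Route `EisensteinPrimes`, crux 2 `GoodLatticeBDPValue` (stmt-BirchSwinnertonDyer-19032), line `halves` v20/v20.1, stub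
# `stub_indexPlumbing` part (B2), AT THE CRUX BINDERS: the sub-character `ω̃ = θsub` of the residual pair IS ramified
# at `v̄`, hence `H¹_{𝓕_Gr^{S₀}}(K_∞, (F/𝒪)(ω̃)) = H¹_{𝓕_nr^{S₀}}(K_∞, (F/𝒪)(ω̃))` and `λ(𝔛^{S₀}_nr(ω̃)) = corank_{ℤ_p} R((F/𝒪)(ω̃))`

Cell `bsd-eis` (home `run/shared/lean/pub/bsd-eis/`), width seat `bsd-line-x1-p1-w8` («width 8»; `--supports -19032`,
closes nothing). The «`+ 0`» half of step (8) of the V21 index road (`Cruxes/GoodLatticeBDPValue/Lines/halves-imprimLambda-index-road.md`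
§2 (8): «`A_ω^{I_j} = 0` ⟹ `L_ω = 0`, `λ_nr(ω̃) = λ_str(ω̃)`») was assembled by w4 gen 3 for a character `θ` RAMIFIED at `v̄`
(`CharResidualSelmerCount.grSelmer_charModule_eq_unrSelmer_of_ramified`, p644436, hypothesis `∃ τ ∈ I_v̄, unitChar θ τ ≠ 1`);
its docstring and `…RamifiedCharNoLocalFixed` leave «`θsub` of the residual pair IS ramified at `v̄`» to be supplied. This
file supplies it from the crux hypotheses and exports the (B2) input of `stub_indexPlumbing` in its own binders:

* §1 **`exists_mem_inertia_unitChar_ne_one_of_isResidualPairOver`** — `W/ℚ` globally minimal, `p` odd, `Anom W p`, no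
  unramified rational `p`-line (`hGL`), `K` imaginary quadratic, `p = v v̄`: for the residual pair
  `IsResidualPairOver (W.baseChange K) p θsub θquot` there is `τ ∈ I_v̄` with `unitChar θsub τ ≠ 1` — the stable line of LEAD
  g3's `ResidualPairStableLine.exists_stableLine_of_isResidualPairOver` is MOVED by `I_v̄` (w2 gen 3's
  `AnomalousLocalTorsion.exists_mem_inertia_smul_ne`, read through w6's `IndexInputsH0.map_subtype_line`), and `τ` acts on
  `(F/𝒪)(θsub) ⊇ j₁(Φ)` by `unitChar θsub τ`.
* §2 **`grSelmer_eq_unrSelmer_sub_of_isResidualPairOver`** — for EVERY `ℤ_p`-extension `κ` of `K` and every `S₀`: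
  `grSelmer κ (charModule ∅ θsub) v̄ S₀ = unrSelmer κ (charModule ∅ θsub) v̄ S₀`.
* §3 **`lambdaInvariant_eq_zpCorank_grSelmer_sub`** — for any dual datum `DSsub` of `H¹_{𝓕_nr^{S₀}}(K_∞, (F/𝒪)(θsub))`
  finitely generated torsion with `μ = 0`: `λ(DSsub.X) = zpCorank (grSelmer κ (charModule ∅ θsub) v̄ S₀)`
  (`grSelmer = datumStrictSelmer (ker κ) … (bdpData … v̄) S₀` by `rfl` is the LEAD's `R((F/𝒪)(θsub))`); with the `∀ D` cotorsion
  antecedent `hSsub` of the registered stub: `…_of_forall`.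

HONEST FRAMING: helper theorems only (0 definitions, 0 named facts, 0 sorry); no summit statement, no BSD / IMC2 / KY Thm
1.4.1 (iii) is proved; 0 stubs / cells / labels move. References: [KellerYin2024] Prop. 1.3.1 («`φ|_{G_p} = ω`»), proof of
Lemma 1.2.4, §1.4 (arXiv:2402.12781v2 TeX L790–795, L877, L1240–1260); [Serre1972] §1.11 Prop. 12; [GreenbergLNM1716] §1 p. 60.
-/

set_option autoImplicit false
-- the route's Theorems namespace repeats the summit name by design (D-0017 nested layout)
set_option linter.dupNamespace false

noncomputable section

open scoped Classical AddSubgroup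

namespace Summit.BirchSwinnertonDyer.BirchSwinnertonDyer.Theorems.IndexPlumbingNrVsStrict

open Function NumberField IsDedekindDomain Field WeierstrassCurve
  Literature.NumberTheory.EllipticCurves Literature.NumberTheory.EllipticCurves.GreenbergSelmer
  Literature.NumberTheory.EllipticCurves.GreenbergVatsal2000 Literature.NumberTheory.GaloisRepresentations
  Literature.NumberTheory.EllipticCurves.KellerYin2024 Literature.NumberTheory.IwasawaTheory
  Literature.NumberTheory.EllipticCurves.Rank1Residual
  Summit.BirchSwinnertonDyer.Rank1Residual Summit.BirchSwinnertonDyer.Rank1Residual.X2.ResidualDevissageModules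

variable (W : WeierstrassCurve ℚ) [W.IsElliptic] [W.IsGloballyMinimal] {p : ℕ} [hp : Fact p.Prime]
  {K : Type} [Field K] [NumberField K]

/-! ## §1 `θsub` is ramified at `v̄` -/

/-- **The sub-character of the residual pair is RAMIFIED at `v̄`**: on the binders of crux 2 (`p` odd, `Anom W p`, no
unramified rational `p`-line, `K` imaginary quadratic, `p = v v̄`) and for `IsResidualPairOver (W.baseChange K) p θsub θquot`,
some `τ ∈ I_v̄` has `unitChar θsub τ ≠ 1`: the stable line `Φ ≤ E_K[p]` is moved by `I_v̄`
(`AnomalousLocalTorsion.exists_mem_inertia_smul_ne`) and embeds equivariantly into `(F/𝒪)(θsub)`, where `τ` acts by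
`unitChar θsub τ`. KY Prop. 1.3.1: «`φ|_{G_p} = ω`» for the good lattice.
[cite: KellerYin2024, Prop. 1.3.1 and §1.4 display (char to f) (arXiv:2402.12781v2 TeX L877, L1063–1087)] [cite: Serre1972, §1.11 Prop. 12] -/
theorem exists_mem_inertia_unitChar_ne_one_of_isResidualPairOver (hp2 : p ≠ 2) (hanom : Anom W p)
    (hGL : ∀ Φ : AddSubgroup (geomTorsion W (p : ℤ)), IsRationalLine W p Φ → ¬ LineUnramifiedAt W p Φ)
    (hK : IsImaginaryQuadratic K) {v vbar : HeightOneSpectrum (𝓞 K)} (hpv : ((p : ℕ) : 𝓞 K) ∈ v.asIdeal)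
    (hpvbar : ((p : ℕ) : 𝓞 K) ∈ vbar.asIdeal) (hne : vbar ≠ v)
    {θsub θquot : FramedGaloisRep K (padicCoeffIntegers (∅ : Set (PadicAlgCl p))) 1}
    (hpair : IsResidualPairOver (W.baseChange K) p θsub θquot) :
    ∃ τ ∈ inertia vbar, unitChar θsub τ ≠ 1 := by
  haveI hEK : (W.baseChange K).IsElliptic := inferInstanceAs (W.map (algebraMap ℚ K)).IsElliptic
  obtain ⟨Φ, hSub, -, ⟨j, hj, hinj, -⟩, -⟩ :=
    ResidualPairStableLine.exists_stableLine_of_isResidualPairOver (W.baseChange K) hpair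
  obtain ⟨hle, hcard, hstab, hmem⟩ := IndexInputsH0.map_subtype_line W Φ
  rw [hSub] at hcard
  obtain ⟨τ, hτ, P, hP, hτP⟩ :=
    AnomalousLocalTorsion.exists_mem_inertia_smul_ne W hp2 hanom hGL hK hpv hpvbar hne hle hcard hstab
  refine ⟨τ, hτ, fun h1 ↦ hτP ?_⟩
  obtain ⟨Q, hQ, rfl⟩ := hP
  -- the point as an element of the stable line, fixed by `τ` because `τ` acts trivially on `(F/𝒪)(θsub)`
  let y : Φ.Sub := ⟨Q, hQ⟩
  have hy : τ • y = y := by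
    apply hinj
    rw [hj]
    obtain ⟨z, hz⟩ := (charModuleEquiv θsub).symm.surjective (j y)
    rw [← hz, CharResidualSelmerFinite.galois_smul_charModuleEquiv_symm, h1, Units.val_one, one_smul]
  have h := congrArg (fun x : Φ.Sub ↦ ((Φ.incl x : ↥((W.baseChange K).geomTorsion (p : ℤ))) :
    geomPoints (W.baseChange K))) hy
  simp only [StableSubgroup.incl_smul, AddSubgroup.torsionBy.coe_smul] at h
  exact h

/-! ## §2 `H¹_{𝓕_Gr^{S₀}} = H¹_{𝓕_nr^{S₀}}` for `(F/𝒪)(θsub)` -/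

variable (κ : ZpExtension K p)

/-- **`H¹_{𝓕_Gr^{S₀}}(K_∞, (F/𝒪)(θsub)) = H¹_{𝓕_nr^{S₀}}(K_∞, (F/𝒪)(θsub))`** for the sub-character of the residual pair at a
good anomalous place, EVERY `ℤ_p`-extension `κ` of `K` and every `S₀` (w4 gen 3's `grSelmer_charModule_eq_unrSelmer_of_ramified`
at §1's inertia element; `θsub` is a Teichmüller lift by `IsResidualPairOver.pow_sub_one`). V21 step (8): `λ_nr(ω̃) = λ_str(ω̃)`.
[cite: KellerYin2024, proof of Lemma 1.2.4 and §1.4 (arXiv:2402.12781v2 TeX L790–795, L1240–1260)] -/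
theorem grSelmer_eq_unrSelmer_sub_of_isResidualPairOver (hp2 : p ≠ 2) (hanom : Anom W p)
    (hGL : ∀ Φ : AddSubgroup (geomTorsion W (p : ℤ)), IsRationalLine W p Φ → ¬ LineUnramifiedAt W p Φ)
    (hK : IsImaginaryQuadratic K) {v vbar : HeightOneSpectrum (𝓞 K)} (hpv : ((p : ℕ) : 𝓞 K) ∈ v.asIdeal)
    (hpvbar : ((p : ℕ) : 𝓞 K) ∈ vbar.asIdeal) (hne : vbar ≠ v)
    {θsub θquot : FramedGaloisRep K (padicCoeffIntegers (∅ : Set (PadicAlgCl p))) 1}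
    (hpair : IsResidualPairOver (W.baseChange K) p θsub θquot) (S₀ : Set (HeightOneSpectrum (𝓞 K))) :
    grSelmer κ (charModule (∅ : Set (PadicAlgCl p)) θsub) vbar S₀ =
      unrSelmer κ (charModule (∅ : Set (PadicAlgCl p)) θsub) vbar S₀ := by
  obtain ⟨τ, hτ, hne1⟩ := exists_mem_inertia_unitChar_ne_one_of_isResidualPairOver W hp2 hanom hGL hK hpv hpvbar hne hpair
  exact CharResidualSelmerCount.grSelmer_charModule_eq_unrSelmer_of_ramified κ vbar S₀ θsub
    (fun σ ↦ (hpair.pow_sub_one σ).1) hτ hne1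

/-! ## §3 `λ(DSsub.X) = corank_{ℤ_p} H¹_{𝓕_Gr^{S₀}}(K_∞, (F/𝒪)(θsub))` -/

/-- **`λ(DSsub.X) = zpCorank (grSelmer κ (charModule ∅ θsub) v̄ S₀)`** for any dual datum `DSsub` of
`H¹_{𝓕_nr^{S₀}}(K_∞, (F/𝒪)(θsub))` that is finitely generated `Λ`-torsion with `μ = 0` (so `λ = corank_{ℤ_p}` of the character
group, `X2.NonPrimitiveSelmerCorank.finite_torsionBy_and_zpCorank_eq_lambdaInvariant`), and §2. The (B2) input — the
`θsub` summand — of the `λ`-inequality of `stub_indexPlumbing` (LEAD g4, halves v20.1).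
[cite: KellerYin2024, Thm. 1.4.1 (iii) and §1.4 (arXiv:2402.12781v2 TeX L1087–1098, L1240–1260)] [cite: GreenbergLNM1716, §1 p. 60] -/
theorem lambdaInvariant_eq_zpCorank_grSelmer_sub (hp2 : p ≠ 2) (hanom : Anom W p)
    (hGL : ∀ Φ : AddSubgroup (geomTorsion W (p : ℤ)), IsRationalLine W p Φ → ¬ LineUnramifiedAt W p Φ)
    (hK : IsImaginaryQuadratic K) {v vbar : HeightOneSpectrum (𝓞 K)} (hpv : ((p : ℕ) : 𝓞 K) ∈ v.asIdeal)
    (hpvbar : ((p : ℕ) : 𝓞 K) ∈ vbar.asIdeal) (hne : vbar ≠ v) {γ : absoluteGaloisGroup K}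
    {θsub θquot : FramedGaloisRep K (padicCoeffIntegers (∅ : Set (PadicAlgCl p))) 1}
    (hpair : IsResidualPairOver (W.baseChange K) p θsub θquot) (S₀ : Set (HeightOneSpectrum (𝓞 K)))
    (DSsub : DatumDualData κ γ (charModule (∅ : Set (PadicAlgCl p)) θsub)
      (Castella2018.AcSelmer.bdpData (charModule (∅ : Set (PadicAlgCl p)) θsub) p vbar) S₀)
    [Module.Finite (IwasawaAlgebra p) DSsub.X] (htor : Module.IsTorsion (IwasawaAlgebra p) DSsub.X)
    (hμ : muInvariant p DSsub.X = 0) :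
    lambdaInvariant p DSsub.X = zpCorank ↥(grSelmer κ (charModule (∅ : Set (PadicAlgCl p)) θsub) vbar S₀) p := by
  have hprimU : ∀ u : ↥(unrSelmer κ (charModule (∅ : Set (PadicAlgCl p)) θsub) vbar S₀), ∃ n : ℕ, p ^ n • u = 0 :=
    fun u ↦ by
      obtain ⟨n, hn⟩ := GreenbergSelmer.exists_pow_smul_subgroupH1_eq_zero κ (charModule (∅ : Set (PadicAlgCl p)) θsub)
        (GreenbergSelmer.exists_pow_smul_cofree_eq_zero (∅ : Set (PadicAlgCl p)) θsub)
        (u : subgroupH1 κ.kerSubgroup (charModule (∅ : Set (PadicAlgCl p)) θsub))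
      exact ⟨n, Subtype.ext (by rw [AddSubgroupClass.coe_nsmul]; exact hn)⟩
  obtain ⟨-, hcork⟩ :=
    X2.NonPrimitiveSelmerCorank.finite_torsionBy_and_zpCorank_eq_lambdaInvariant p DSsub.X htor hμ hprimU DSsub.toDualEquiv
  rw [← hcork, grSelmer_eq_unrSelmer_sub_of_isResidualPairOver W κ hp2 hanom hGL hK hpv hpvbar hne hpair S₀]

/-- **The same with the `∀ D` cotorsion antecedent of the registered stub** (`hSsub : ∀ D, Module.Finite ∧ IsTorsion ∧ μ = 0`,
[PWL-θ] through KY Prop. 1.2.5), instantiated at `DSsub`. [cite: KellerYin2024, Thm. 1.4.1 (i)–(iii) (arXiv:2402.12781v2 TeX L1087–1098)] -/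
theorem lambdaInvariant_eq_zpCorank_grSelmer_sub_of_forall (hp2 : p ≠ 2) (hanom : Anom W p)
    (hGL : ∀ Φ : AddSubgroup (geomTorsion W (p : ℤ)), IsRationalLine W p Φ → ¬ LineUnramifiedAt W p Φ)
    (hK : IsImaginaryQuadratic K) {v vbar : HeightOneSpectrum (𝓞 K)} (hpv : ((p : ℕ) : 𝓞 K) ∈ v.asIdeal)
    (hpvbar : ((p : ℕ) : 𝓞 K) ∈ vbar.asIdeal) (hne : vbar ≠ v) {γ : absoluteGaloisGroup K}
    {θsub θquot : FramedGaloisRep K (padicCoeffIntegers (∅ : Set (PadicAlgCl p))) 1}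
    (hpair : IsResidualPairOver (W.baseChange K) p θsub θquot) (S₀ : Set (HeightOneSpectrum (𝓞 K)))
    (DSsub : DatumDualData κ γ (charModule (∅ : Set (PadicAlgCl p)) θsub)
      (Castella2018.AcSelmer.bdpData (charModule (∅ : Set (PadicAlgCl p)) θsub) p vbar) S₀)
    (hSsub : ∀ D : DatumDualData κ γ (charModule (∅ : Set (PadicAlgCl p)) θsub)
        (Castella2018.AcSelmer.bdpData (charModule (∅ : Set (PadicAlgCl p)) θsub) p vbar) S₀,
      Module.Finite (IwasawaAlgebra p) D.X ∧ Module.IsTorsion (IwasawaAlgebra p) D.X ∧ muInvariant p D.X = 0) :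
    lambdaInvariant p DSsub.X = zpCorank ↥(grSelmer κ (charModule (∅ : Set (PadicAlgCl p)) θsub) vbar S₀) p := by
  obtain ⟨hfg, htor, hμ⟩ := hSsub DSsub
  haveI := hfg
  exact lambdaInvariant_eq_zpCorank_grSelmer_sub W κ hp2 hanom hGL hK hpv hpvbar hne hpair S₀ DSsub htor hμ

end Summit.BirchSwinnertonDyer.BirchSwinnertonDyer.Theorems.IndexPlumbingNrVsStrict

end
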